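import Mathlib
import HarnessLib
import Literature.Analysis.Convex.AlmostContractions
import Literature.Analysis.Convex.IshikawaNonexpansive

/-!
# The Ishikawa iteration for Zamfirescu, Kannan and Chatterjea operators in arbitrary Banach
# spaces (Berinde 2004), with Rhoades' uniformly-convex theorems as corollaries

[cite: Berinde2007, Ch. 5 "The Ishikawa Iteration", §5.4 "Quasi-nonexpansive type operators",
pp. 127–131 of the printed book (Theorem 5.6 and the printed part of its proof, the Remark after
Theorem 5.7, Theorem 5.8 with its complete proof (28)–(35), the Remark after it, Corollaries 5.2,
5.3 and the closing Remark); Ch. 4 §4.2, Theorems 4.9 and 4.10, pp. 100–104; bibliographical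
comments §5.6, pp. 132–134 and §4.4, pp. 109–111]

V. Berinde, *Iterative Approximation of Fixed Points*, 2nd ed., Lecture Notes in Mathematics
1912, Springer 2007, doi:10.1007/978-3-540-72234-2 (held: `lit` key
`book:berinde2007-iterative-approximation-fixed-points`; bib key `Berinde2007`).  Attributions
(§5.6, §4.4 of the book): "Theorem 5.8 and Corollaries 5.2 and 5.3 are taken from Berinde
[Be04c]" — V. Berinde, *On the convergence of the Ishikawa iteration in the class of quasi
contractive operators*, Acta Math. Univ. Comenianae **73** (2004) 119–126; "Theorem 5.6, is taken
from Rhoades [Rho76], Theorem 8" — B. E. Rhoades, *Comments on two fixed point iteration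
methods*, J. Math. Anal. Appl. **56** (1976) 741–750; "Theorem 4.9 in this section is Theorem 4
in Rhoades [Rh74a], slightly reformulated" — B. E. Rhoades, *Fixed point iterations using
infinite matrices*, Trans. Amer. Math. Soc. **196** (1974) 161–176; "Theorem 4.10 is Theorem 2
in Berinde [Be03e]".  Everything below is formalised from the book's complete proof of
Theorem 5.8; nothing here is new mathematics.

## Setting and what is formalised

`E` is a real normed space (`[NormedAddCommGroup E] [NormedSpace ℝ E]`); `[CompleteSpace E]` is
added exactly where a fixed point has to be produced (Theorem 2.4 of the book, from the tree).
`K : Set E` is convex with `MapsTo T K K` for `T : E → E`; `α β : ℕ → ℝ` take values in `[0, 1]`;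
the Ishikawa iteration (28)–(29), `x_{n+1} = (1 - α_n) x_n + α_n T y_n`,
`y_n = (1 - β_n) x_n + β_n T x_n`, is the predicate `IsIshikawaSeq T α β x`
(`∀ n, x (n + 1) = (1 - α n) • x n + α n • T ((1 - β n) • x n + β n • T (x n))`) of
`Literature.Analysis.Convex.IshikawaNonexpansive` (§5.3 of the book in the tree), whose `inner_mem`,
`IsIshikawaSeq.mem` (the iterates stay in `K`) and `isIshikawaSeq_of_mann` are used by name; the
Mann iteration is the hypothesis `∀ n, x (n + 1) = (1 - α n) • x n + α n • T (x n)`.  The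
real-sequence step `Π_{k<n} (1 - u_k) ≤ exp (-Σ_{k<n} u_k) → 0` when `Σ u_k = ∞` is carried out
inside the proof of `tendsto_prod_one_sub_sq_mul` (the same computation as
`Literature.Analysis.Convex.ConvergenceRateComparison.tendsto_prod_one_sub`, Ch. 9 in the tree).
Condition (ii) `Σ α_n = ∞` is `Tendsto (fun n => ∑ k ∈ range n, α k) atTop atTop`, condition (i)
of Theorem 5.6 `Σ α_n (1 - α_n) = ∞` is the same with `α k * (1 - α k)`.  The operator classes
are the tree's (`Literature.Analysis.Convex.AlmostContractions`, by name): Zamfirescu operators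
`IsZamfirescuMapping T a b c` with `δ = IsZamfirescuMapping.delta` ((7) of Ch. 4), Kannan
operators `IsKannanMapping T a`, Chatterjea operators `IsChatterjeaMapping T c`, and condition
(8) of Ch. 4 = (42) of Ch. 2, `‖T x - T y‖ ≤ θ ‖x - y‖ + L ‖x - T x‖`,
`BerindeUniquenessCondition T θ L`.

* The engine of the proof of Theorem 5.8, stated once under the only property of `T` it uses,
  (31)/(33): `‖T z - p‖ ≤ δ ‖z - p‖` for `z ∈ K` and a fixed point `p ∈ K` —
  (32) `‖y_n - p‖ ≤ (1 - β_n + β_n δ) ‖x_n - p‖` (`norm_inner_sub_le`), the one-step estimate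
  `‖x_{n+1} - p‖ ≤ [1 - (1 - δ) α_n (1 + δ β_n)] ‖x_n - p‖` and (34)
  `‖x_{n+1} - p‖ ≤ [1 - (1 - δ)² α_n] ‖x_n - p‖` (`norm_succ_sub_le`, `norm_succ_sub_le'`),
  (35) `‖x_n - p‖ ≤ Π_{k<n} [1 - (1 - δ)² α_k] ‖x_0 - p‖` (`norm_sub_le_prod_mul`),
  `Π_{k<n} [1 - (1 - δ)² α_k] → 0` under (ii) (`tendsto_prod_one_sub_sq_mul`) and the conclusion
  `x_n → p` (`tendsto_of_norm_map_sub_le`); for `δ ≤ 1` (quasi-nonexpansiveness w.r.t. `p`, the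
  printed part of the proof of Theorem 5.6) `‖x_n - p‖` is non-increasing (`antitone_norm_sub`).
* Condition (8) of Ch. 4 with a fixed point `p` gives (31)/(33) with `δ = θ`
  (`norm_map_sub_le_of_cond`), hence the Ishikawa iteration converges to `p` under (ii) for every
  `T` satisfying `BerindeUniquenessCondition T θ L` on `E` (`tendsto_of_cond`; compare
  `Literature.Analysis.Convex.IterationStability.tendsto_ishikawa_of_cond4`, Theorem 7.2 of the
  book, which assumes `α_n ≥ α > 0` instead of (ii)).
* **Theorem 5.8** (Berinde 2004) for a Zamfirescu operator on `E`: convergence to a given fixed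
  point with the estimate (35) for Zamfirescu's `δ` (`tendsto_of_zamfirescu`,
  `norm_sub_le_prod_mul_of_zamfirescu`), and, for `E` Banach, existence and uniqueness of the
  fixed point together with the convergence (`exists_tendsto_of_zamfirescu`); the book's form with
  `T : K → K` on a closed convex `K` (`exists_tendsto_of_zamfirescu_restrict`).
* **Corollary 5.2** (Kannan operators: `tendsto_of_kannan`, `exists_tendsto_of_kannan`) and
  **Corollary 5.3** (Chatterjea operators: `tendsto_of_chatterjea`, `exists_tendsto_of_chatterjea`).
* The closing Remark: Theorem 4.10 (the Mann iteration, `β_n ≡ 0`: `tendsto_mann_of_zamfirescu`;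
  this is also `Literature.Analysis.Convex.ConvergenceRateComparison.tendsto_mannSeq_zam` of the
  tree, re-derived here in two lines from Theorem 5.8 as the book does) and the Krasnoselskij
  iteration `α_n ≡ λ ∈ (0, 1]`, `β_n ≡ 0` (`tendsto_krasnoselskij_of_zamfirescu`; `λ = 1` is the
  Picard iteration, Theorem 2.4, in the tree as `IsZamfirescuMapping.tendsto_iterate_fixedPoint`).
* The Remark after Theorem 5.8: (i) implies (ii) (`tendsto_sum_of_tendsto_sum_mul_one_sub`), hence
  **Theorem 5.6** (Rhoades 1976, Theorem 8; `exists_tendsto_of_zamfirescu_of_sum_mul`) and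
  **Theorem 4.9** (Rhoades 1974, Theorem 4; `tendsto_mann_of_zamfirescu_of_sum_mul`) follow from
  Theorem 5.8 — see deviation (ii).

## Deviations

(i) As in `ConvergenceRateComparison` (Theorem 4.10 there), the operator classes are taken on the
whole space `E` (the tree's structures are over a metric space `X`, here `X = E`); the book has
`T : K → K` on a closed convex subset `K` of a Banach space.  The engine (`norm_succ_sub_le`, …,
`tendsto_of_norm_map_sub_le`) is stated relative to a convex `K` with `MapsTo T K K`, and
Theorem 5.8 is also given in the book's form, for `IsZamfirescuMapping (hTK.restrict T K K) a b c`
on the subtype `↥K` (`exists_tendsto_of_zamfirescu_restrict`); closedness of `K` and completeness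
of `E` enter only there and in the `exists_` statements, through Theorem 2.4
(`IsZamfirescuMapping.existsUnique_fixedPoint` of the tree).
(ii) Theorems 5.6 and 4.9 are stated by the book for `E` uniformly convex (Theorem 4.9 moreover
with `α_1 = 1`, `0 ≤ α_n < 1`) and proved there by a uniform-convexity argument (Groetsch's
lemma).  As the book itself remarks after Theorem 5.8, condition (i) implies (ii) and Theorem 5.8
holds in an arbitrary Banach space; accordingly both are derived here from Theorem 5.8, for `E`
Banach and `α_n ∈ [0, 1]`, and the book's own proofs of 5.6 / 4.9 are not formalised (only the
monotonicity of `‖x_n - p‖`, the printed part of the proof of Theorem 5.6, is: `antitone_norm_sub`).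
(iii) Theorem 5.7 (Xu 1992 / Ciric 1997, quasi-contractions with `y_n` in a convex hull) is stated
in the book without proof and is not formalised; nor are the Remarks after it.
(iv) The statement of Theorem 5.8 printed in the book reads "condition (z₁) - (z₂)"; its proof
uses (8) of Ch. 4, i.e. Zamfirescu's (z₁)–(z₃) through `δ` of (7), and the theorem is formalised
for Zamfirescu operators (and, more generally, for condition (8) with a fixed point).
(v) In (35) the book writes the product up to `n` for `‖x_{n+1} - p‖`; here
`‖x_n - p‖ ≤ (Π_{k<n} …) ‖x_0 - p‖` for every `n`, the same statement shifted by one.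
-/

open Filter Topology Set Function
open Literature.Analysis.Convex.AlmostContractions
open Literature.Analysis.Convex.IshikawaNonexpansive

namespace Literature.Analysis.Convex.IshikawaZamfirescu

/-! ## The Remark after Theorem 5.8: (i) implies (ii) -/

section RealLemmas

/-- The Remark after Theorem 5.8: condition (i) `Σ α_n (1 - α_n) = ∞` of Theorem 5.6 implies
condition (ii) `Σ α_n = ∞` of Theorem 5.8, since `α_n (1 - α_n) = α_n - α_n² ≤ α_n` (for every
real `α_n`; the book notes `0 < α_n (1 - α_n) < α_n`).
[cite: Berinde2007, Ch. 5 §5.4, Remark after Thm 5.8, pp. 127–131] -/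
theorem tendsto_sum_of_tendsto_sum_mul_one_sub {α : ℕ → ℝ}
    (h : Tendsto (fun n => ∑ k ∈ Finset.range n, α k * (1 - α k)) atTop atTop) :
    Tendsto (fun n => ∑ k ∈ Finset.range n, α k) atTop atTop :=
  tendsto_atTop_mono (fun n => Finset.sum_le_sum fun k _ => by nlinarith [sq_nonneg (α k)]) h

end RealLemmas

variable {E : Type*} [NormedAddCommGroup E] [NormedSpace ℝ E]

/-! ## The engine of the proof of Theorem 5.8: operators with `‖T z - p‖ ≤ δ ‖z - p‖` on `K` -/

section Engine

variable {K : Set E} {T : E → E} {α β : ℕ → ℝ} {x : ℕ → E} {p : E} {δ : ℝ}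

/-- (32)–(33): if `‖T z - p‖ ≤ δ ‖z - p‖` then `‖(1 - b) z + b T z - p‖ ≤ (1 - b + b δ) ‖z - p‖`
for `b ∈ [0, 1]`.
[cite: Berinde2007, Ch. 5 §5.4, Thm 5.8 (32)–(33), pp. 127–131] -/
theorem norm_inner_sub_le {z : E} (hq : ‖T z - p‖ ≤ δ * ‖z - p‖) {b : ℝ}
    (hb : b ∈ Icc (0 : ℝ) 1) : ‖(1 - b) • z + b • T z - p‖ ≤ (1 - b + b * δ) * ‖z - p‖ := by
  have e : (1 - b) • z + b • T z - p = (1 - b) • (z - p) + b • (T z - p) := by module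
  rw [e]
  calc ‖(1 - b) • (z - p) + b • (T z - p)‖ ≤ ‖(1 - b) • (z - p)‖ + ‖b • (T z - p)‖ :=
        norm_add_le _ _
    _ = (1 - b) * ‖z - p‖ + b * ‖T z - p‖ := by
        rw [norm_smul_of_nonneg (sub_nonneg.2 hb.2), norm_smul_of_nonneg hb.1]
    _ ≤ (1 - b) * ‖z - p‖ + b * (δ * ‖z - p‖) :=
        add_le_add le_rfl (mul_le_mul_of_nonneg_left hq hb.1)
    _ = (1 - b + b * δ) * ‖z - p‖ := by ring

/-- (30)–(33) combined: the one-step estimate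
`‖x_{n+1} - p‖ ≤ [1 - (1 - δ) α_n (1 + δ β_n)] ‖x_n - p‖` for the Ishikawa step at a point
`x_n ∈ K`, when `‖T z - p‖ ≤ δ ‖z - p‖` on `K` (`δ ≥ 0`).
[cite: Berinde2007, Ch. 5 §5.4, Thm 5.8 (30)–(33), pp. 127–131] -/
theorem norm_succ_sub_le (hK : Convex ℝ K) (hTK : MapsTo T K K)
    (hq : ∀ z ∈ K, ‖T z - p‖ ≤ δ * ‖z - p‖) (hδ : 0 ≤ δ) {n : ℕ} (hn : x n ∈ K)
    (ha : α n ∈ Icc (0 : ℝ) 1) (hb : β n ∈ Icc (0 : ℝ) 1)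
    (hx : x (n + 1) = (1 - α n) • x n + α n • T ((1 - β n) • x n + β n • T (x n))) :
    ‖x (n + 1) - p‖ ≤ (1 - (1 - δ) * α n * (1 + δ * β n)) * ‖x n - p‖ := by
  set y : E := (1 - β n) • x n + β n • T (x n) with hy
  have hyK : y ∈ K := inner_mem hK hTK hn hb
  -- (32)–(33)
  have h32 : ‖y - p‖ ≤ (1 - β n + β n * δ) * ‖x n - p‖ := norm_inner_sub_le (hq _ hn) hb
  -- (31)
  have h31 : ‖T y - p‖ ≤ δ * ((1 - β n + β n * δ) * ‖x n - p‖) :=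
    (hq y hyK).trans (mul_le_mul_of_nonneg_left h32 hδ)
  -- (30)
  have e : x (n + 1) - p = (1 - α n) • (x n - p) + α n • (T y - p) := by rw [hx]; module
  rw [e]
  calc ‖(1 - α n) • (x n - p) + α n • (T y - p)‖
        ≤ ‖(1 - α n) • (x n - p)‖ + ‖α n • (T y - p)‖ := norm_add_le _ _
    _ = (1 - α n) * ‖x n - p‖ + α n * ‖T y - p‖ := by
        rw [norm_smul_of_nonneg (sub_nonneg.2 ha.2), norm_smul_of_nonneg ha.1]
    _ ≤ (1 - α n) * ‖x n - p‖ + α n * (δ * ((1 - β n + β n * δ) * ‖x n - p‖)) :=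
        add_le_add le_rfl (mul_le_mul_of_nonneg_left h31 ha.1)
    _ = (1 - (1 - δ) * α n * (1 + δ * β n)) * ‖x n - p‖ := by ring

/-- The "obvious inequality" `1 - (1 - δ) α_n (1 + δ β_n) ≤ 1 - (1 - δ)² α_n` for `0 ≤ δ ≤ 1`,
`α_n, β_n ≥ 0`. [cite: Berinde2007, Ch. 5 §5.4, Thm 5.8 (before (34)), pp. 127–131] -/
theorem one_sub_le_one_sub_sq_mul {a b : ℝ} (hδ0 : 0 ≤ δ) (hδ1 : δ ≤ 1) (ha : 0 ≤ a)
    (hb : 0 ≤ b) : 1 - (1 - δ) * a * (1 + δ * b) ≤ 1 - (1 - δ) ^ 2 * a := by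
  nlinarith [mul_nonneg (mul_nonneg (sub_nonneg.2 hδ1) ha) (add_nonneg (mul_nonneg hδ0 hb) hδ0)]

/-- (34): `‖x_{n+1} - p‖ ≤ [1 - (1 - δ)² α_n] ‖x_n - p‖` (`0 ≤ δ ≤ 1`).
[cite: Berinde2007, Ch. 5 §5.4, Thm 5.8 (34), pp. 127–131] -/
theorem norm_succ_sub_le' (hK : Convex ℝ K) (hTK : MapsTo T K K)
    (hq : ∀ z ∈ K, ‖T z - p‖ ≤ δ * ‖z - p‖) (hδ : δ ∈ Icc (0 : ℝ) 1) {n : ℕ} (hn : x n ∈ K)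
    (ha : α n ∈ Icc (0 : ℝ) 1) (hb : β n ∈ Icc (0 : ℝ) 1)
    (hx : x (n + 1) = (1 - α n) • x n + α n • T ((1 - β n) • x n + β n • T (x n))) :
    ‖x (n + 1) - p‖ ≤ (1 - (1 - δ) ^ 2 * α n) * ‖x n - p‖ :=
  (norm_succ_sub_le hK hTK hq hδ.1 hn ha hb hx).trans
    (mul_le_mul_of_nonneg_right (one_sub_le_one_sub_sq_mul hδ.1 hδ.2 ha.1 hb.1) (norm_nonneg _))

/-- The printed part of the proof of Theorem 5.6: when `‖T z - p‖ ≤ δ ‖z - p‖` on `K` with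
`δ ≤ 1` (in particular for a quasi-nonexpansive `T`, `δ = 1`), `‖x_{n+1} - p‖ ≤ ‖x_n - p‖`, i.e.
`{‖x_n - p‖}` is non-increasing.
[cite: Berinde2007, Ch. 5 §5.4, proof of Thm 5.6, pp. 127–131] -/
theorem antitone_norm_sub (hK : Convex ℝ K) (hTK : MapsTo T K K)
    (hq : ∀ z ∈ K, ‖T z - p‖ ≤ δ * ‖z - p‖) (hδ : δ ∈ Icc (0 : ℝ) 1)
    (hα : ∀ n, α n ∈ Icc (0 : ℝ) 1) (hβ : ∀ n, β n ∈ Icc (0 : ℝ) 1) (hx0 : x 0 ∈ K)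
    (hx : IsIshikawaSeq T α β x) :
    Antitone fun n => ‖x n - p‖ := by
  refine antitone_nat_of_succ_le fun n => ?_
  have h := norm_succ_sub_le hK hTK hq hδ.1 (hx.mem hK hTK hα hβ hx0 n) (hα n)
    (hβ n) (hx n)
  have hc : 1 - (1 - δ) * α n * (1 + δ * β n) ≤ 1 := by
    have : 0 ≤ (1 - δ) * α n * (1 + δ * β n) :=
      mul_nonneg (mul_nonneg (sub_nonneg.2 hδ.2) (hα n).1) (by nlinarith [hδ.1, (hβ n).1])
    linarith
  exact h.trans ((mul_le_mul_of_nonneg_right hc (norm_nonneg _)).trans_eq (one_mul _))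

/-- (35): `‖x_n - p‖ ≤ Π_{k<n} [1 - (1 - δ)² α_k] · ‖x_0 - p‖`.
[cite: Berinde2007, Ch. 5 §5.4, Thm 5.8 (35), pp. 127–131] -/
theorem norm_sub_le_prod_mul (hK : Convex ℝ K) (hTK : MapsTo T K K)
    (hq : ∀ z ∈ K, ‖T z - p‖ ≤ δ * ‖z - p‖) (hδ : δ ∈ Icc (0 : ℝ) 1)
    (hα : ∀ n, α n ∈ Icc (0 : ℝ) 1) (hβ : ∀ n, β n ∈ Icc (0 : ℝ) 1) (hx0 : x 0 ∈ K)
    (hx : IsIshikawaSeq T α β x) (n : ℕ) :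
    ‖x n - p‖ ≤ (∏ k ∈ Finset.range n, (1 - (1 - δ) ^ 2 * α k)) * ‖x 0 - p‖ := by
  induction n with
  | zero => simp
  | succ n ih =>
    have h34 := norm_succ_sub_le' hK hTK hq hδ (hx.mem hK hTK hα hβ hx0 n) (hα n)
      (hβ n) (hx n)
    have hc : 0 ≤ 1 - (1 - δ) ^ 2 * α n := by
      have h1 : (1 - δ) ^ 2 ≤ 1 := by nlinarith [hδ.1, hδ.2]
      nlinarith [(hα n).1, (hα n).2, sq_nonneg (1 - δ)]
    calc ‖x (n + 1) - p‖ ≤ (1 - (1 - δ) ^ 2 * α n) * ‖x n - p‖ := h34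
      _ ≤ (1 - (1 - δ) ^ 2 * α n) *
            ((∏ k ∈ Finset.range n, (1 - (1 - δ) ^ 2 * α k)) * ‖x 0 - p‖) :=
          mul_le_mul_of_nonneg_left ih hc
      _ = (∏ k ∈ Finset.range (n + 1), (1 - (1 - δ) ^ 2 * α k)) * ‖x 0 - p‖ := by
          rw [Finset.prod_range_succ]; ring

/-- `Π_{k<n} [1 - (1 - δ)² α_k] → 0` when `0 ≤ δ < 1`, `α_k ∈ [0, 1]` and `Σ α_k = ∞`.
[cite: Berinde2007, Ch. 5 §5.4, proof of Thm 5.8 (after (35)), pp. 127–131] -/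
theorem tendsto_prod_one_sub_sq_mul (hδ : δ ∈ Ico (0 : ℝ) 1) (hα : ∀ n, α n ∈ Icc (0 : ℝ) 1)
    (hdiv : Tendsto (fun n => ∑ k ∈ Finset.range n, α k) atTop atTop) :
    Tendsto (fun n => ∏ k ∈ Finset.range n, (1 - (1 - δ) ^ 2 * α k)) atTop (𝓝 0) := by
  have hc : 0 < (1 - δ) ^ 2 := pow_pos (sub_pos.2 hδ.2) 2
  have hc1 : (1 - δ) ^ 2 ≤ 1 := by nlinarith [hδ.1, hδ.2]
  have hle1 : ∀ k, (1 - δ) ^ 2 * α k ≤ 1 := fun k => by nlinarith [(hα k).1, (hα k).2]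
  -- `Σ_{k<n} (1 - δ)² α_k → ∞`
  have hsum : Tendsto (fun n => ∑ k ∈ Finset.range n, (1 - δ) ^ 2 * α k) atTop atTop := by
    simp_rw [← Finset.mul_sum]
    exact hdiv.const_mul_atTop hc
  -- `Π_{k<n} (1 - u_k) ≤ exp (-Σ_{k<n} u_k)` from `1 - u ≤ e^{-u}`, and the right side tends to `0`
  have hexp : Tendsto (fun n => Real.exp (-∑ k ∈ Finset.range n, (1 - δ) ^ 2 * α k)) atTop
      (𝓝 0) := Real.tendsto_exp_atBot.comp (tendsto_neg_atTop_atBot.comp hsum)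
  refine tendsto_of_tendsto_of_tendsto_of_le_of_le tendsto_const_nhds hexp
    (fun n => Finset.prod_nonneg fun k _ => sub_nonneg.2 (hle1 k)) fun n => ?_
  rw [← Finset.sum_neg_distrib, Real.exp_sum]
  exact Finset.prod_le_prod (fun k _ => sub_nonneg.2 (hle1 k))
    fun k _ => Real.one_sub_le_exp_neg _

/-- The conclusion of the proof of Theorem 5.8, under the only property of `T` it uses: if `K` is
convex, `T(K) ⊆ K`, `p ∈ E` satisfies `‖T z - p‖ ≤ δ ‖z - p‖` for all `z ∈ K` with `0 ≤ δ < 1`,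
`α_n, β_n ∈ [0, 1]` and `Σ α_n = ∞`, then the Ishikawa iteration started in `K` converges
(strongly) to `p`.
[cite: Berinde2007, Ch. 5 §5.4, Thm 5.8 (proof), pp. 127–131] -/
theorem tendsto_of_norm_map_sub_le (hK : Convex ℝ K) (hTK : MapsTo T K K)
    (hq : ∀ z ∈ K, ‖T z - p‖ ≤ δ * ‖z - p‖) (hδ : δ ∈ Ico (0 : ℝ) 1)
    (hα : ∀ n, α n ∈ Icc (0 : ℝ) 1) (hβ : ∀ n, β n ∈ Icc (0 : ℝ) 1)
    (hdiv : Tendsto (fun n => ∑ k ∈ Finset.range n, α k) atTop atTop) (hx0 : x 0 ∈ K)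
    (hx : IsIshikawaSeq T α β x) :
    Tendsto x atTop (𝓝 p) := by
  rw [tendsto_iff_norm_sub_tendsto_zero]
  have hlim := (tendsto_prod_one_sub_sq_mul hδ hα hdiv).mul_const ‖x 0 - p‖
  rw [zero_mul] at hlim
  exact tendsto_of_tendsto_of_tendsto_of_le_of_le tendsto_const_nhds hlim
    (fun n => norm_nonneg _)
    (norm_sub_le_prod_mul hK hTK hq ⟨hδ.1, hδ.2.le⟩ hα hβ hx0 hx)

omit [NormedSpace ℝ E] in
/-- Under `‖T z - p‖ ≤ δ ‖z - p‖` on `K` with `δ < 1`, `p` is the only fixed point of `T` in `K`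
("the fixed point" in Theorem 5.8).
[cite: Berinde2007, Ch. 5 §5.4, Thm 5.8, pp. 127–131] -/
theorem eq_of_norm_map_sub_le (hq : ∀ z ∈ K, ‖T z - p‖ ≤ δ * ‖z - p‖) (hδ : δ < 1) {q : E}
    (hqK : q ∈ K) (hTq : T q = q) : q = p := by
  have h := hq q hqK
  rw [hTq] at h
  have h0 : ‖q - p‖ = 0 := by nlinarith [norm_nonneg (q - p)]
  exact sub_eq_zero.1 (norm_eq_zero.1 h0)

end Engine

/-! ## Condition (8) of Ch. 4 (= (42) of Ch. 2) and Theorem 5.8 -/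

section Operators

variable {T : E → E} {α β : ℕ → ℝ} {x : ℕ → E} {p : E}

omit [NormedSpace ℝ E] in
/-- (31)/(33): condition (8) of Ch. 4, `‖T x - T y‖ ≤ θ ‖x - y‖ + L ‖x - T x‖`, applied with
`x := p` a fixed point gives `‖T z - p‖ ≤ θ ‖z - p‖`.
[cite: Berinde2007, Ch. 5 §5.4, Thm 5.8 (31), (33), pp. 127–131] -/
theorem norm_map_sub_le_of_cond {θ L : ℝ} (h : BerindeUniquenessCondition T θ L) (hp : T p = p)
    (z : E) : ‖T z - p‖ ≤ θ * ‖z - p‖ := by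
  have h1 := h.dist_le p z
  rw [hp, dist_self, mul_zero, add_zero, dist_comm, dist_comm p z, dist_eq_norm,
    dist_eq_norm] at h1
  exact h1

/-- Theorem 5.8 in the generality its proof gives: if `T : E → E` satisfies condition (8) of
Ch. 4, `BerindeUniquenessCondition T θ L` (`0 ≤ θ < 1`), and `p` is a fixed point, then for
`α_n, β_n ∈ [0, 1]` with `Σ α_n = ∞` the Ishikawa iteration converges to `p` from every `x_0`.
(Theorem 7.2 of the book, `IterationStability.tendsto_ishikawa_of_cond4` in the tree, has the same
conclusion under `α_n ≥ α > 0`.)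
[cite: Berinde2007, Ch. 5 §5.4, Thm 5.8, pp. 127–131] -/
theorem tendsto_of_cond {θ L : ℝ} (h : BerindeUniquenessCondition T θ L) (hp : T p = p)
    (hα : ∀ n, α n ∈ Icc (0 : ℝ) 1) (hβ : ∀ n, β n ∈ Icc (0 : ℝ) 1)
    (hdiv : Tendsto (fun n => ∑ k ∈ Finset.range n, α k) atTop atTop)
    (hx : IsIshikawaSeq T α β x) :
    Tendsto x atTop (𝓝 p) :=
  tendsto_of_norm_map_sub_le convex_univ (mapsTo_univ T univ)
    (fun z _ => norm_map_sub_le_of_cond h hp z) ⟨h.nonneg, h.lt_one⟩ hα hβ hdiv (mem_univ _) hx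

/-- **Theorem 5.8** (Berinde 2004), for a Zamfirescu operator `T` on `E` with fixed point `p`:
for `α_n, β_n ∈ [0, 1]` with (ii) `Σ α_n = ∞`, the Ishikawa iteration (28)–(29) converges
strongly to `p` from every starting point.
[cite: Berinde2007, Ch. 5 §5.4, Thm 5.8, pp. 127–131] -/
theorem tendsto_of_zamfirescu {a b c : ℝ} (h : IsZamfirescuMapping T a b c) (hp : T p = p)
    (hα : ∀ n, α n ∈ Icc (0 : ℝ) 1) (hβ : ∀ n, β n ∈ Icc (0 : ℝ) 1)
    (hdiv : Tendsto (fun n => ∑ k ∈ Finset.range n, α k) atTop atTop)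
    (hx : IsIshikawaSeq T α β x) :
    Tendsto x atTop (𝓝 p) :=
  tendsto_of_cond h.berindeUniquenessCondition hp hα hβ hdiv hx

/-- The estimate (35) of Theorem 5.8 with Zamfirescu's `δ` ((7) of Ch. 4,
`IsZamfirescuMapping.delta`): `‖x_n - p‖ ≤ Π_{k<n} [1 - (1 - δ)² α_k] · ‖x_0 - p‖`.
[cite: Berinde2007, Ch. 5 §5.4, Thm 5.8 (35), pp. 127–131] -/
theorem norm_sub_le_prod_mul_of_zamfirescu {a b c : ℝ} (h : IsZamfirescuMapping T a b c)
    (hp : T p = p) (hα : ∀ n, α n ∈ Icc (0 : ℝ) 1) (hβ : ∀ n, β n ∈ Icc (0 : ℝ) 1)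
    (hx : IsIshikawaSeq T α β x) (n : ℕ) :
    ‖x n - p‖ ≤ (∏ k ∈ Finset.range n, (1 - (1 - h.delta) ^ 2 * α k)) * ‖x 0 - p‖ :=
  norm_sub_le_prod_mul convex_univ (mapsTo_univ T univ)
    (fun z _ => norm_map_sub_le_of_cond h.berindeUniquenessCondition hp z)
    ⟨h.delta_nonneg, h.delta_lt_one.le⟩ hα hβ (mem_univ _) hx n

/-- **Theorem 5.8** (Berinde 2004) with the fixed point produced by Theorem 2.4: for a Zamfirescu
operator `T` on a Banach space `E`, `α_n, β_n ∈ [0, 1]` with `Σ α_n = ∞`, there is a unique fixed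
point `p` and the Ishikawa iteration converges strongly to it from every starting point.
[cite: Berinde2007, Ch. 5 §5.4, Thm 5.8, pp. 127–131] -/
theorem exists_tendsto_of_zamfirescu [CompleteSpace E] {a b c : ℝ}
    (h : IsZamfirescuMapping T a b c) (hα : ∀ n, α n ∈ Icc (0 : ℝ) 1)
    (hβ : ∀ n, β n ∈ Icc (0 : ℝ) 1)
    (hdiv : Tendsto (fun n => ∑ k ∈ Finset.range n, α k) atTop atTop)
    (hx : IsIshikawaSeq T α β x) :
    ∃ p : E, T p = p ∧ (∀ q, T q = q → q = p) ∧ Tendsto x atTop (𝓝 p) := by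
  haveI : Nonempty E := ⟨x 0⟩
  obtain ⟨p, hp, hu⟩ := h.existsUnique_fixedPoint
  exact ⟨p, hp, hu, tendsto_of_zamfirescu h hp hα hβ hdiv hx⟩

/-- **Theorem 5.8** in the book's form `T : K → K`: `K` a closed convex subset of a Banach space
`E`, `T` mapping `K` into itself and Zamfirescu on `K` (the tree's `IsZamfirescuMapping` for the
restriction `hTK.restrict T K K : K → K`), `α_n, β_n ∈ [0, 1]`, `Σ α_n = ∞`, `x_0 ∈ K`: there is a
(unique in `K`) fixed point `p ∈ K` of `T` and the Ishikawa iteration converges strongly to it.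
[cite: Berinde2007, Ch. 5 §5.4, Thm 5.8, pp. 127–131] -/
theorem exists_tendsto_of_zamfirescu_restrict [CompleteSpace E] {K : Set E} (hKc : IsClosed K)
    (hK : Convex ℝ K) (hTK : MapsTo T K K) {a b c : ℝ}
    (h : IsZamfirescuMapping (hTK.restrict T K K) a b c) (hα : ∀ n, α n ∈ Icc (0 : ℝ) 1)
    (hβ : ∀ n, β n ∈ Icc (0 : ℝ) 1)
    (hdiv : Tendsto (fun n => ∑ k ∈ Finset.range n, α k) atTop atTop) (hx0 : x 0 ∈ K)
    (hx : IsIshikawaSeq T α β x) :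
    ∃ p ∈ K, T p = p ∧ (∀ q ∈ K, T q = q → q = p) ∧ Tendsto x atTop (𝓝 p) := by
  haveI : CompleteSpace K := hKc.completeSpace_coe
  haveI : Nonempty K := ⟨⟨x 0, hx0⟩⟩
  obtain ⟨q, hq, -⟩ := h.existsUnique_fixedPoint
  have hTq : T (q : E) = q := by
    have := congrArg Subtype.val hq
    rwa [MapsTo.val_restrict_apply] at this
  -- (31)/(33) on `K`, from Example 2.5 of the tree applied on the subtype `↥K`
  have hqc : ∀ z ∈ K, ‖T z - q‖ ≤ h.delta * ‖z - q‖ := by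
    intro z hz
    have h1 := h.dist_map_fixedPoint_le hq ⟨z, hz⟩
    rw [Subtype.dist_eq, Subtype.dist_eq, MapsTo.val_restrict_apply, dist_eq_norm,
      dist_eq_norm] at h1
    exact h1
  exact ⟨q, q.2, hTq, fun r hr hTr => eq_of_norm_map_sub_le hqc h.delta_lt_one hr hTr,
    tendsto_of_norm_map_sub_le hK hTK hqc ⟨h.delta_nonneg, h.delta_lt_one⟩ hα hβ hdiv hx0 hx⟩

/-! ## Corollaries 5.2 (Kannan) and 5.3 (Chatterjea) -/

/-- **Corollary 5.2**: for a Kannan operator ((8) of Ch. 2) with fixed point `p`,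
`α_n, β_n ∈ [0, 1]` and `Σ α_n = ∞`, the Ishikawa iteration converges strongly to `p`.
[cite: Berinde2007, Ch. 5 §5.4, Cor 5.2, pp. 127–131] -/
theorem tendsto_of_kannan {a : ℝ} (h : IsKannanMapping T a) (hp : T p = p)
    (hα : ∀ n, α n ∈ Icc (0 : ℝ) 1) (hβ : ∀ n, β n ∈ Icc (0 : ℝ) 1)
    (hdiv : Tendsto (fun n => ∑ k ∈ Finset.range n, α k) atTop atTop)
    (hx : IsIshikawaSeq T α β x) :
    Tendsto x atTop (𝓝 p) :=
  tendsto_of_cond h.berindeUniquenessCondition hp hα hβ hdiv hx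

/-- **Corollary 5.2** with the fixed point produced (Kannan's fixed point theorem, Theorem 2.3,
from the tree): `E` Banach.
[cite: Berinde2007, Ch. 5 §5.4, Cor 5.2, pp. 127–131] -/
theorem exists_tendsto_of_kannan [CompleteSpace E] {a : ℝ} (h : IsKannanMapping T a)
    (hα : ∀ n, α n ∈ Icc (0 : ℝ) 1) (hβ : ∀ n, β n ∈ Icc (0 : ℝ) 1)
    (hdiv : Tendsto (fun n => ∑ k ∈ Finset.range n, α k) atTop atTop)
    (hx : IsIshikawaSeq T α β x) :
    ∃ p : E, T p = p ∧ (∀ q, T q = q → q = p) ∧ Tendsto x atTop (𝓝 p) := by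
  haveI : Nonempty E := ⟨x 0⟩
  obtain ⟨p, hp, hu⟩ := h.existsUnique_fixedPoint
  exact ⟨p, hp, hu, tendsto_of_kannan h hp hα hβ hdiv hx⟩

/-- **Corollary 5.3**: for a Chatterjea operator ((34) of Ch. 2) with fixed point `p`,
`α_n, β_n ∈ [0, 1]` and `Σ α_n = ∞`, the Ishikawa iteration converges strongly to `p`.
[cite: Berinde2007, Ch. 5 §5.4, Cor 5.3, pp. 127–131] -/
theorem tendsto_of_chatterjea {c : ℝ} (h : IsChatterjeaMapping T c) (hp : T p = p)
    (hα : ∀ n, α n ∈ Icc (0 : ℝ) 1) (hβ : ∀ n, β n ∈ Icc (0 : ℝ) 1)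
    (hdiv : Tendsto (fun n => ∑ k ∈ Finset.range n, α k) atTop atTop)
    (hx : IsIshikawaSeq T α β x) :
    Tendsto x atTop (𝓝 p) :=
  tendsto_of_cond h.berindeUniquenessCondition hp hα hβ hdiv hx

/-- **Corollary 5.3** with the fixed point produced (Chatterjea's fixed point theorem from the
tree): `E` Banach.
[cite: Berinde2007, Ch. 5 §5.4, Cor 5.3, pp. 127–131] -/
theorem exists_tendsto_of_chatterjea [CompleteSpace E] {c : ℝ} (h : IsChatterjeaMapping T c)
    (hα : ∀ n, α n ∈ Icc (0 : ℝ) 1) (hβ : ∀ n, β n ∈ Icc (0 : ℝ) 1)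
    (hdiv : Tendsto (fun n => ∑ k ∈ Finset.range n, α k) atTop atTop)
    (hx : IsIshikawaSeq T α β x) :
    ∃ p : E, T p = p ∧ (∀ q, T q = q → q = p) ∧ Tendsto x atTop (𝓝 p) := by
  haveI : Nonempty E := ⟨x 0⟩
  obtain ⟨p, hp, hu⟩ := h.existsUnique_fixedPoint
  exact ⟨p, hp, hu, tendsto_of_chatterjea h hp hα hβ hdiv hx⟩

/-! ## The closing Remark: Mann (Theorem 4.10), Krasnoselskij and Picard as special cases -/

/-- The closing Remark, **Theorem 4.10** (Berinde 2003) as the case `β_n ≡ 0` of Theorem 5.8: for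
a Zamfirescu operator with fixed point `p`, `α_n ∈ [0, 1]`, `Σ α_n = ∞`, the Mann iteration
converges strongly to `p` (in the tree also as `ConvergenceRateComparison.tendsto_mannSeq_zam`).
[cite: Berinde2007, Ch. 5 §5.4, closing Remark, pp. 127–131; Ch. 4 §4.2, Thm 4.10, pp. 100–104] -/
theorem tendsto_mann_of_zamfirescu {a b c : ℝ} (h : IsZamfirescuMapping T a b c) (hp : T p = p)
    (hα : ∀ n, α n ∈ Icc (0 : ℝ) 1)
    (hdiv : Tendsto (fun n => ∑ k ∈ Finset.range n, α k) atTop atTop)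
    (hx : ∀ n, x (n + 1) = (1 - α n) • x n + α n • T (x n)) : Tendsto x atTop (𝓝 p) :=
  tendsto_of_zamfirescu (β := fun _ => 0) h hp hα (fun _ => ⟨le_rfl, zero_le_one⟩) hdiv
    (isIshikawaSeq_of_mann hx)

/-- The closing Remark, the Krasnoselskij iteration `x_{n+1} = (1 - λ) x_n + λ T x_n`,
`λ ∈ (0, 1]` (`α_n ≡ λ`, `β_n ≡ 0`; `λ = 1` is the Picard iteration of Theorem 2.4): it converges
strongly to the fixed point `p` of a Zamfirescu operator.  (For `λ = 0` the sequence is constant,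
so the book's "`λ ∈ [0, 1]`" needs `λ > 0` for (ii).)
[cite: Berinde2007, Ch. 5 §5.4, closing Remark, pp. 127–131] -/
theorem tendsto_krasnoselskij_of_zamfirescu {a b c : ℝ} (h : IsZamfirescuMapping T a b c)
    (hp : T p = p) {lam : ℝ} (hl0 : 0 < lam) (hl1 : lam ≤ 1)
    (hx : ∀ n, x (n + 1) = (1 - lam) • x n + lam • T (x n)) : Tendsto x atTop (𝓝 p) := by
  refine tendsto_mann_of_zamfirescu (α := fun _ => lam) h hp (fun _ => ⟨hl0.le, hl1⟩) ?_ hx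
  simp only [Finset.sum_const, Finset.card_range, nsmul_eq_mul]
  exact tendsto_natCast_atTop_atTop.atTop_mul_const hl0

/-! ## Theorems 5.6 and 4.9 (Rhoades) as corollaries of Theorem 5.8 -/

/-- **Theorem 5.6** (Rhoades 1976, Theorem 8), derived from Theorem 5.8 as indicated in the
Remark after it ((i) implies (ii)) — see deviation (ii): for a Zamfirescu operator on a Banach
space `E`, `α_n, β_n ∈ [0, 1]` with (i) `Σ α_n (1 - α_n) = ∞`, the Ishikawa iteration converges
strongly to the unique fixed point of `T`.
[cite: Berinde2007, Ch. 5 §5.4, Thm 5.6 and the Remark after Thm 5.8, pp. 127–131] -/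
theorem exists_tendsto_of_zamfirescu_of_sum_mul [CompleteSpace E] {a b c : ℝ}
    (h : IsZamfirescuMapping T a b c) (hα : ∀ n, α n ∈ Icc (0 : ℝ) 1)
    (hβ : ∀ n, β n ∈ Icc (0 : ℝ) 1)
    (hdiv : Tendsto (fun n => ∑ k ∈ Finset.range n, α k * (1 - α k)) atTop atTop)
    (hx : IsIshikawaSeq T α β x) :
    ∃ p : E, T p = p ∧ (∀ q, T q = q → q = p) ∧ Tendsto x atTop (𝓝 p) :=
  exists_tendsto_of_zamfirescu h hα hβ
    (tendsto_sum_of_tendsto_sum_mul_one_sub hdiv) hx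

/-- **Theorem 4.9** (Rhoades 1974, Theorem 4), derived from Theorem 4.10 / 5.8 — see deviation
(ii): for a Zamfirescu operator with fixed point `p`, `α_n ∈ [0, 1]` with (iii)
`Σ α_n (1 - α_n) = ∞`, the Mann iteration converges strongly to `p`.
[cite: Berinde2007, Ch. 4 §4.2, Thm 4.9, pp. 100–104; Ch. 5 §5.4, Remark after Thm 5.8,
pp. 127–131] -/
theorem tendsto_mann_of_zamfirescu_of_sum_mul {a b c : ℝ} (h : IsZamfirescuMapping T a b c)
    (hp : T p = p) (hα : ∀ n, α n ∈ Icc (0 : ℝ) 1)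
    (hdiv : Tendsto (fun n => ∑ k ∈ Finset.range n, α k * (1 - α k)) atTop atTop)
    (hx : ∀ n, x (n + 1) = (1 - α n) • x n + α n • T (x n)) : Tendsto x atTop (𝓝 p) :=
  tendsto_mann_of_zamfirescu h hp hα (tendsto_sum_of_tendsto_sum_mul_one_sub hdiv) hx

end Operators

end Literature.Analysis.Convex.IshikawaZamfirescu
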